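import Mathlib
import Summits.NavierStokesRegularity.NavierStokesRegularity.Theorems.L3TimeExponentPincerRingFamily
import Summits.NavierStokesRegularity.NavierStokesRegularity.Theorems.L3TimeExponentPincerCritModulusLinearLower
import HarnessLib.Audit
import HarnessLib

/-!
# L3TimeExponentPincer — rings force LINEAR growth of the swirl-free critical modulus
# (`CritSmoothingNoSwirl`); the effective modulus `C(1+A)^m` needs `m ≥ 1`

Support kernel for the crux `L3CascadeJaw` (item stmt-NavierStokesRegularity-19499); sequel of
`…CritModulusLinearLower` (frame version) and `…RingFamily` (the ring family as Tao-class
swirl-free axisymmetric solutions).  The ROUND-12/13 nodes of seat nsreg-p2 for the swirl-free class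
are `CritSmoothingNoSwirl Φ` (`‖u(t)‖_∞ ≤ Φ(‖u₀‖₃) t^{-1/2}` along Tao-class solutions from
axisymmetric swirl-free data, `ν = 1`) and the EFFECTIVE form
`CritSmoothingNoSwirlPoly := ∃ C m, CritSmoothingNoSwirl (fun A ↦ C (1+A)^m)`.  The viscous rings ARE
swirl-free axisymmetric Tao-class solutions, so they calibrate these nodes directly:

* `critSmoothingNoSwirl_linear_lower` — `CritSmoothingNoSwirl Φ → ∃ κ A₀ > 0, ∀ A ≥ A₀, κA ≤ Φ(A)`;
* `exists_poly_lt_linear` — real analysis: for `m < 1`, `C(1+A)^m < κA` for some `A ≥ A₀`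
  (any `κ, A₀ > 0`);
* `one_le_of_critSmoothingNoSwirl_poly` — **`CritSmoothingNoSwirl (fun A ↦ C(1+A)^m) → 1 ≤ m`**:
  any witness of `CritSmoothingNoSwirlPoly` has exponent `m ≥ 1` (Kato's linear shape is the floor);
  `one_le_of_critSmoothing_poly` — the same for the frame modulus `CritSmoothing`;
  `not_critSmoothingNoSwirl_const` — no constant swirl-free modulus.

WHAT THIS IS NOT: not NS regularity or blow-up; does not refute `CritSmoothingNoSwirlB` /
`CritSmoothingNoSwirlPoly` (`m ≥ 1` remains open and is consistent with Gallay–Šverák); the crux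
`L3CascadeJaw` and the hard cores are untouched; no crux claim.
-/

namespace Summit.NavierStokesRegularity.NavierStokesRegularity.Theorems.L3TimeExponentPincerCritModulusNoSwirlLinearLower

open Real Set Filter MeasureTheory Literature.Analysis.FluidPDE
open Summit.NavierStokesRegularity.NavierStokesRegularity.Theorems.L3TimeExponentPincerQuantJaw
open Summit.NavierStokesRegularity.NavierStokesRegularity.Theorems.L3TimeExponentPincerCritModulus
open Summit.NavierStokesRegularity.NavierStokesRegularity.Theorems.L3TimeExponentPincerCritModulusLinearLower
open Summit.NavierStokesRegularity.NavierStokesRegularity.Theorems.L3TimeExponentPincerRingFamily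
open scoped ENNReal NNReal Topology

/-! ### A. The swirl-free critical modulus is at least linear -/

/-- **Rings force linear growth of the swirl-free critical modulus.**  If `CritSmoothingNoSwirl Φ`
holds then there are absolute `κ, A₀ > 0` with `κ A ≤ Φ(A)` for every `A ≥ A₀`. -/
theorem critSmoothingNoSwirl_linear_lower {Φ : ℝ → ℝ} (hΦ : CritSmoothingNoSwirl Φ) :
    ∃ κ A₀ : ℝ, 0 < κ ∧ 0 < A₀ ∧ ∀ A : ℝ, A₀ ≤ A → κ * A ≤ Φ A := by
  obtain ⟨c, C₀, hc, hc1, hC₀, hfam⟩ := taoRingFamily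
  refine ⟨c ^ 3 * Real.sqrt c / (2 * C₀), C₀, by positivity, hC₀, fun A hA => ?_⟩
  have hA0 : 0 < A := hC₀.trans_le hA
  have hsc : 0 < Real.sqrt c := Real.sqrt_pos.2 hc
  -- the scale `ℓ = (C₀/A)²`
  obtain ⟨ℓ, hℓ⟩ : ∃ ℓ : ℝ, ℓ = (C₀ / A) ^ 2 := ⟨_, rfl⟩
  have hℓ0 : 0 < ℓ := by rw [hℓ]; positivity
  have hℓ1 : ℓ ≤ 1 := by
    rw [hℓ]
    have h1 : C₀ / A ≤ 1 := by rw [div_le_one hA0]; exact hA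
    have h0 : 0 ≤ C₀ / A := by positivity
    nlinarith
  have hlh : ℓ ^ (-(1 / 2 : ℝ)) = A / C₀ := by
    rw [hℓ, Real.rpow_neg (sq_nonneg _), ← Real.sqrt_eq_rpow, Real.sqrt_sq (by positivity), inv_div]
  obtain ⟨u₀, u, pr, hsol, hax, hsw, hF, hE, hdat, hfloor⟩ := hfam ℓ hℓ0 hℓ1
  have hdat' : eLpNorm u₀ 3 volume ≤ ENNReal.ofReal A := by
    rw [hlh, mul_div_cancel₀ _ hC₀.ne'] at hdat
    exact hdat
  -- the time `t = s²`, `s = √c C₀²/(2A²)` (so `t = cℓ²/4`)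
  obtain ⟨s, hs⟩ : ∃ s : ℝ, s = Real.sqrt c * C₀ ^ 2 / (2 * A ^ 2) := ⟨_, rfl⟩
  have hs0 : 0 < s := by rw [hs]; positivity
  have hts : (s ^ 2) ^ (-(1 / 2 : ℝ)) = s⁻¹ := by
    rw [Real.rpow_neg (sq_nonneg _), ← Real.sqrt_eq_rpow, Real.sqrt_sq hs0.le]
  have ht_eq : s ^ 2 = c * ℓ ^ 2 / 4 := by
    rw [hs, hℓ, div_pow, mul_pow, Real.sq_sqrt hc.le]; ring
  have hℓ2 : ℓ ^ (2 : ℝ) = ℓ ^ 2 := Real.rpow_two ℓ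
  have hcl : 0 < c * ℓ ^ 2 := by positivity
  have ht0 : 0 < s ^ 2 := by positivity
  have htw : s ^ 2 ∈ Ioo 0 (c * ℓ ^ (2 : ℝ)) := ⟨ht0, by rw [hℓ2, ht_eq]; linarith⟩
  have ht1 : s ^ 2 < 1 := by
    have : c * ℓ ^ 2 ≤ 1 := by
      calc c * ℓ ^ 2 ≤ 1 * 1 := by gcongr; nlinarith
        _ = 1 := one_mul _
    rw [ht_eq]; linarith
  -- the three inputs: modulus, floor, energy
  have hsup := hΦ 1 A one_pos hA0.le u₀ u pr hsol hax hsw hdat' (s ^ 2) ⟨ht0, ht1⟩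
  have hfl := hfloor (s ^ 2) htw
  have hen : ∫⁻ x, ‖u (s ^ 2) x‖ₑ ^ 2 ≤ 1 :=
    (frame_lintegral_sq_le_energy0 zero_le_one hF ⟨ht0.le, ht1.le⟩).trans hE
  have hint := eLpNorm_three_rpow_le_of_top_two (μ := volume)
    (frame_aestronglyMeasurable hF ⟨ht0, ht1⟩) (q := 3) (by norm_num)
  rw [show (3 : ℝ) / 3 = 1 by norm_num, ENNReal.rpow_one, ENNReal.rpow_one,
    show (3 : ℝ) = ((3 : ℕ) : ℝ) by norm_num, ENNReal.rpow_natCast] at hint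
  -- chain in `ℝ≥0∞`
  have hx0 : 0 ≤ c * ℓ ^ (-(1 / 2 : ℝ)) := by positivity
  have key : ENNReal.ofReal ((c * ℓ ^ (-(1 / 2 : ℝ))) ^ 3) ≤
      ENNReal.ofReal (Φ A * (s ^ 2) ^ (-(1 / 2 : ℝ))) := by
    calc ENNReal.ofReal ((c * ℓ ^ (-(1 / 2 : ℝ))) ^ 3)
        = ENNReal.ofReal (c * ℓ ^ (-(1 / 2 : ℝ))) ^ 3 := ENNReal.ofReal_pow hx0 3
      _ ≤ eLpNorm (u (s ^ 2)) 3 volume ^ 3 := by gcongr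
      _ ≤ eLpNorm (u (s ^ 2)) ⊤ volume * ∫⁻ x, ‖u (s ^ 2) x‖ₑ ^ 2 := hint
      _ ≤ ENNReal.ofReal (Φ A) * ENNReal.ofReal ((s ^ 2) ^ (-(1 / 2 : ℝ))) * 1 := by
          gcongr
      _ = ENNReal.ofReal (Φ A * (s ^ 2) ^ (-(1 / 2 : ℝ))) := by
          rw [mul_one, ← ENNReal.ofReal_mul' (Real.rpow_nonneg ht0.le _)]
  -- back to `ℝ`
  have hpos : 0 < (c * ℓ ^ (-(1 / 2 : ℝ))) ^ 3 := by positivity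
  have hreal : (c * ℓ ^ (-(1 / 2 : ℝ))) ^ 3 ≤ Φ A * (s ^ 2) ^ (-(1 / 2 : ℝ)) := by
    rcases ENNReal.ofReal_le_ofReal_iff'.1 key with h | h
    · exact h
    · exact absurd h (not_le.2 hpos)
  rw [hts, hlh] at hreal
  have e : c ^ 3 * Real.sqrt c / (2 * C₀) * A = (c * (A / C₀)) ^ 3 * s := by
    rw [hs]; field_simp; try ring
  rw [e]
  exact (le_mul_inv_iff₀ hs0).1 hreal


/-! ### B. Real analysis: a sub-linear power is eventually below every linear function -/

/-- For `m < 1` and any `κ, A₀ > 0` there is `A ≥ A₀` with `C (1+A)^m < κ A`. -/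
theorem exists_poly_lt_linear (C m : ℝ) (hm : m < 1) {κ A₀ : ℝ} (hκ : 0 < κ) (hA₀ : 0 < A₀) :
    ∃ A : ℝ, A₀ ≤ A ∧ C * (1 + A) ^ m < κ * A := by
  obtain ⟨m', hm'⟩ : ∃ m' : ℝ, m' = max m 0 := ⟨_, rfl⟩
  have hm'0 : 0 ≤ m' := by rw [hm']; exact le_max_right _ _
  have hm'1 : m' < 1 := by rw [hm']; exact max_lt hm one_pos
  have hmm' : m ≤ m' := by rw [hm']; exact le_max_left _ _
  have ht : Tendsto (fun A : ℝ => (|C| + 1) * 2 ^ m' * A ^ (-(1 - m'))) atTop (𝓝 0) := by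
    have h := (tendsto_rpow_neg_atTop (by linarith : 0 < 1 - m')).const_mul ((|C| + 1) * 2 ^ m')
    rw [mul_zero] at h
    exact h
  have h1 : ∀ᶠ A in atTop, (|C| + 1) * 2 ^ m' * A ^ (-(1 - m')) < κ :=
    ht.eventually (gt_mem_nhds hκ)
  obtain ⟨A, hA1, hA2, hA3⟩ :=
    (h1.and ((eventually_ge_atTop A₀).and (eventually_ge_atTop (1 : ℝ)))).exists
  refine ⟨A, hA2, ?_⟩
  have hA0 : 0 < A := by linarith
  have hb1 : (1 + A) ^ m ≤ (1 + A) ^ m' := Real.rpow_le_rpow_of_exponent_le (by linarith) hmm'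
  have hb2 : (1 + A) ^ m' ≤ (2 * A) ^ m' := Real.rpow_le_rpow (by linarith) (by linarith) hm'0
  have hb3 : (2 * A) ^ m' = 2 ^ m' * A ^ m' := Real.mul_rpow (by norm_num) hA0.le
  have hAm : A ^ (-(1 - m')) * A = A ^ m' := by
    rw [← Real.rpow_add_one hA0.ne']; congr 1; ring
  have hpow : 0 ≤ 2 ^ m' * A ^ (-(1 - m')) := by positivity
  have hlt : |C| * 2 ^ m' * A ^ (-(1 - m')) < κ := by nlinarith [abs_nonneg C]
  calc C * (1 + A) ^ m ≤ |C| * (1 + A) ^ m :=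
        mul_le_mul_of_nonneg_right (le_abs_self C) (Real.rpow_nonneg (by linarith) _)
    _ ≤ |C| * (2 ^ m' * A ^ m') := mul_le_mul_of_nonneg_left (hb1.trans (hb2.trans hb3.le)) (abs_nonneg C)
    _ = |C| * 2 ^ m' * A ^ (-(1 - m')) * A := by rw [← hAm]; ring
    _ < κ * A := mul_lt_mul_of_pos_right hlt hA0

/-! ### C. Consequences: effective moduli have exponent `≥ 1`; no constant modulus -/

/-- **No eventually-sublinear swirl-free critical modulus.** -/
theorem not_critSmoothingNoSwirl_of_eventually_lt {Φ : ℝ → ℝ}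
    (h : ∀ κ A₀ : ℝ, 0 < κ → 0 < A₀ → ∃ A : ℝ, A₀ ≤ A ∧ Φ A < κ * A) :
    ¬ CritSmoothingNoSwirl Φ := by
  intro hΦ
  obtain ⟨κ, A₀, hκ, hA₀, hlow⟩ := critSmoothingNoSwirl_linear_lower hΦ
  obtain ⟨A, hA, hlt⟩ := h κ A₀ hκ hA₀
  exact absurd (hlow A hA) (not_le.2 hlt)

/-- **The effective swirl-free modulus `C(1+A)^m` needs `m ≥ 1`.**  Every witness `(C, m)` of
`CritSmoothingNoSwirlPoly` has `1 ≤ m`. -/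
theorem one_le_of_critSmoothingNoSwirl_poly {C m : ℝ}
    (h : CritSmoothingNoSwirl (fun A => C * (1 + A) ^ m)) : 1 ≤ m := by
  by_contra hm
  rw [not_le] at hm
  exact not_critSmoothingNoSwirl_of_eventually_lt
    (fun κ A₀ hκ hA₀ => exists_poly_lt_linear C m hm hκ hA₀) h

/-- **The frame modulus `C(1+A)^m` needs `m ≥ 1`** (`CritSmoothing`, all frame solutions). -/
theorem one_le_of_critSmoothing_poly {C m : ℝ} (h : CritSmoothing (fun A => C * (1 + A) ^ m)) :
    1 ≤ m := by
  by_contra hm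
  rw [not_le] at hm
  exact not_critSmoothing_of_eventually_lt (fun κ A₀ hκ hA₀ => exists_poly_lt_linear C m hm hκ hA₀) h

/-- **No constant swirl-free critical modulus**: `¬ CritSmoothingNoSwirl (fun _ ↦ C)`. -/
theorem not_critSmoothingNoSwirl_const (C : ℝ) : ¬ CritSmoothingNoSwirl (fun _ => C) := by
  refine not_critSmoothingNoSwirl_of_eventually_lt fun κ A₀ hκ hA₀ => ?_
  refine ⟨max A₀ ((|C| + 1) / κ), le_max_left _ _, ?_⟩
  have h1 : (|C| + 1) / κ ≤ max A₀ ((|C| + 1) / κ) := le_max_right _ _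
  have h2 : |C| + 1 ≤ κ * max A₀ ((|C| + 1) / κ) := by
    rw [div_le_iff₀ hκ] at h1; linarith
  linarith [le_abs_self C]

/--
info: 'Summit.NavierStokesRegularity.NavierStokesRegularity.Theorems.L3TimeExponentPincerCritModulusNoSwirlLinearLower.one_le_of_critSmoothingNoSwirl_poly' depends on axioms: [propext,
 Classical.choice,
 Quot.sound]
-/
#guard_msgs in
#print axioms one_le_of_critSmoothingNoSwirl_poly

end Summit.NavierStokesRegularity.NavierStokesRegularity.Theorems.L3TimeExponentPincerCritModulusNoSwirlLinearLower
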